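import Summits.ABC.IUTFork.Cor312LicenceTameBoundaryGenuineK
import Literature.IUT.LogVolume.UnitLogBallVolumeCriterion
import HarnessLib

/-!
# [IUTchIII] Cor. 3.12, branch C — the boundary deciders SUBSUME the tame ones: a uniformly tame bad fibre (`p > 2`, `e_p ≤ p − 2`) is a
# torsion-free sub-wild fibre (`e_p ≤ p − 1`, no non-trivial `p`-th root of unity), so T1 (p448597 / p449282) is the case `e_p ≤ p − 2` of
# T1½ (p456372 / p456609) — kernel-checked, no new statement of record

PROOF-ONLY record file (no `def`, no new `Prop`, no instance) of the abc-iut cell (branch D seat abc-iut-D1-prv, gen 4; D-0079 R-W row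
«W:T1½ TAME-BOUNDARY lane=U», plan g9 RULING C-R29 (2)). TAKES NO SIDE on [IUTchIII] Cor. 3.12 or on any author. Purpose: the docstrings of
`Cor312LicenceTameBoundaryRealising.lean` / `…GenuineK.lean` (this seat) say that their hypothesis «`p > 2`, `e_p ≤ p − 1`, `∀ ζ ∈ K_x,
ζ^p = 1 → ζ = 1`» CONTAINS abc-iut-w5-d009's uniformly tame hypothesis «`p > 2`, `e_p ≤ p − 2`»; this file makes that containment a kernel
fact (RQ7 reader abc-iut-w4-d037's INFO-1 on p454872: «cite the sequel for the U1½ certification» — and here for the U1 ⊂ U1½ one):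

* §1 `forall_pow_prime_eq_one_of_absRamificationIdx_le_sub_two` — for ANY proper ultrametric normed `ℚ_p`-algebra `K` with `p > 2` and
  `e(K/ℚ_p) ≤ p − 2`: `K` has no `ζ ≠ 1` with `ζ^p = 1` (a primitive `p`-th root of unity forces `(p − 1) ∣ e`, abc-iut-w5-d039/w6-d060 lineage
  `forall_pow_prime_eq_one_of_not_pred_dvd`, Neukirch II (7.13); and `1 ≤ e ≤ p − 2` is not a multiple of `p − 1`);
  `boundaryFibre_of_tameFibre` — the fibre-level bundle: T1's hypothesis on a bad fibre implies T1½'s.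
* §2 two `example`s (no new declaration, so no duplicate statement enters the index): abc-iut-w5-d009's
  `licence_settingPrVolSharp_iff_of_realises_tame` (p448597) and `Cor312Prov.licence_settingPrVolSharp_pilotDataOfK_iff_of_tame` (p449282),
  RE-DERIVED verbatim from this seat's `licence_settingPrVolSharp_iff_of_realises_boundary` (p456372) /
  `Cor312Prov.licence_settingPrVolSharp_pilotDataOfK_iff_of_boundary` (p456609).

READING (numbers, not adjectives): the deciding decls of record for the D-0079 R-W strata U1 (p448597 / p449282) and U1 ∪ U1½ (p456372 / p456609)
agree on U1 BY THEOREM; the WINDOW-TABLE may cite the U1 ∪ U1½ decls for every row with `e_p ≤ p − 1` and «`ζ_p ∉ K_w`», the latter input being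
AUTOMATIC (this file) whenever `e_p ≤ p − 2`. HONEST SCOPE: bookkeeping between OUR typed deciders; nothing about print; nothing asserts or refutes
[IUTchIII] Cor. 3.12; typed ≠ proved.
[cite: NeukirchANT1999, Ch. II Prop. (5.7), (7.13)] [cite: DupuyHilado2025, §3.4, §4.9] [claim: Mochizuki2012, status: disputed] for every IUT
sentence quoted.
-/

noncomputable section

open Set Metric Function NumberField IsDedekindDomain
open scoped Pointwise

namespace Summit.ABC.IUTFork.Thm311.Real

open Cor312 Cor312.Setting Cor312Vol Literature.IUT.LogThetaLattice Literature.IUT.LogVolume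
open Literature.NumberTheory.NumberFields Literature.NumberTheory.GaloisRepresentations.Ultrametric

/-! ## §1. Tame ⇒ torsion-free sub-wild -/

/-- **`p > 2`, `e(K/ℚ_p) ≤ p − 2` ⇒ `K` has no non-trivial `p`-th root of unity**: a primitive `p`-th root forces `(p − 1) ∣ e`
(`forall_pow_prime_eq_one_of_not_pred_dvd`), impossible for `1 ≤ e ≤ p − 2`. So every uniformly TAME bad fibre is a torsion-free sub-wild one,
and the `ζ_p ∉ K_w` input of the U1½ deciders is automatic on U1. [cite: NeukirchANT1999, Ch. II Prop. (5.7), (7.13)] -/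
theorem forall_pow_prime_eq_one_of_absRamificationIdx_le_sub_two (p : ℕ) [Fact p.Prime] (K : Type*) [NontriviallyNormedField K]
    [NormedAlgebra ℚ_[p] K] [IsUltrametricDist K] [ProperSpace K] (hp2 : 2 < p) (he : absRamificationIdx p K ≤ p - 2) :
    ∀ ζ : K, ζ ^ p = 1 → ζ = 1 :=
  forall_pow_prime_eq_one_of_not_pred_dvd p K fun hd => by
    have he1 : 1 ≤ absRamificationIdx p K := absRamificationIdx_pos p K
    have hle : p - 1 ≤ absRamificationIdx p K := Nat.le_of_dvd he1 hd
    omega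

variable {F : Type} [Field F] [NumberField F] (X : PilotData F)

/-- **Fibre-level bundle: T1's hypothesis implies T1½'s.** At a prime `p` under a bad place, «`p > 2`, `e_p ≤ p − 2`, `e(x|p) = e_p` at every
`x | p`» implies «`p > 2`, `e_p ≤ p − 1`, `e(x|p) = e_p`, and `K_x` has no `ζ ≠ 1` with `ζ^p = 1`» (§1 at `K_x`, `e(K_x/ℚ_p) = e(x|p)` by
`absRamificationIdx_rescaledCompletion`). [cite: NeukirchANT1999, Ch. II Prop. (5.7), (7.13)] -/
theorem boundaryFibre_of_tameFibre (e : Nat.Primes → ℕ)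
    (hfib : ∀ (pp : Nat.Primes) (x : (thetaIndex X).Fibre (.inr pp)),
      haveI : Fact (pp : ℕ).Prime := ⟨pp.2⟩
      (∃ w : (thetaIndex X).Fibre (.inr pp), placeOf X pp.1 w ∈ X.S) →
        2 < (pp : ℕ) ∧ e pp ≤ (pp : ℕ) - 2 ∧ (placeOf X pp.1 x).asIdeal.ramificationIdx ℤ = e pp)
    (pp : Nat.Primes) (x : (thetaIndex X).Fibre (.inr pp))
    (hS : haveI : Fact (pp : ℕ).Prime := ⟨pp.2⟩; ∃ w : (thetaIndex X).Fibre (.inr pp), placeOf X pp.1 w ∈ X.S) :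
    haveI : Fact (pp : ℕ).Prime := ⟨pp.2⟩
    2 < (pp : ℕ) ∧ e pp ≤ (pp : ℕ) - 1 ∧ (placeOf X pp.1 x).asIdeal.ramificationIdx ℤ = e pp ∧
      ∀ ζ : kOf X pp.1 x, ζ ^ (pp : ℕ) = 1 → ζ = 1 := by
  haveI : Fact (pp : ℕ).Prime := ⟨pp.2⟩
  obtain ⟨hp2, hep, hram⟩ := hfib pp x hS
  have heK : absRamificationIdx (pp : ℕ) (kOf X pp.1 x) ≤ (pp : ℕ) - 2 :=
    ((absRamificationIdx_rescaledCompletion F (pp : ℕ) (placeOf X pp.1 x) (natCast_mem_placeOf X pp.1 x)).trans hram).le.trans hep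
  exact ⟨hp2, by omega, hram, forall_pow_prime_eq_one_of_absRamificationIdx_le_sub_two (pp : ℕ) (kOf X pp.1 x) hp2 heK⟩

/-! ## §2. T1 as the case `e_p ≤ p − 2` of T1½ (re-derivations; no new declaration) -/

variable {logv : PadicLogs F} (hlog : LogvAnalytic logv)
  (M : Type) [Field M] [NumberField M]
  (archPk : ∀ (j : (thetaIndex X).Label) (vQ : (thetaIndex X).VQ), Set ((logShellsDH X logv).Packet j vQ))
  (archSub : ∀ (j : (thetaIndex X).Label) (v : (thetaIndex X).V),
    Set ((logShellsDH X logv).Packet j ((thetaIndex X).over v)))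
  (Ψ : ℤ → ∀ v : (thetaIndex X).V, v ∈ (thetaIndex X).Vbad → Set ((logShellsDH X logv).StarPacket v))
  (act : ℤ → ∀ v : (thetaIndex X).V, v ∈ (thetaIndex X).Vbad →
    (logShellsDH X logv).StarPacket v → Module.End ℚ ((logShellsDH X logv).StarPacket v))
  (Mmod : ℤ → ∀ j : (thetaIndex X).LabelStar, Set ((logShellsDH X logv).GlobalPacket j.1))
  (region : ℤ → ∀ j : (thetaIndex X).LabelStar, FinDivisor M → ∀ vQ : (thetaIndex X).VQ,
    Set ((logShellsDH X logv).Packet j.1 vQ))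
  (n : ℤ) {HT : Type} {LogLink : HT → HT → Type} {IsFull : ∀ {s t : HT}, LogLink s t → Prop}
  (lat : LGPGaussianLogThetaLattice LogLink IsFull)
  {Frd : Type} {IsoF : Frd → Frd → Type} {Ob : Frd → Type} {realify : Frd → Frd} {Strip : Type}
  {IsoS : Strip → Strip → Type} {Mv : ∀ v : (thetaIndex X).V, v ∈ (thetaIndex X).Vbad → Type}
  [∀ v h, Monoid (Mv v h)]
  (sig : GlobalLGPFrobenioidSignature (thetaIndex X).lstar (thetaIndex X).V (· ∈ (thetaIndex X).Vbad)
    Frd IsoF Ob realify Strip IsoS Mv)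
  (split : SplittingMonoids Mv) {ObΔ : Type} {N : ∀ v : (thetaIndex X).V, v ∈ (thetaIndex X).Vbad → Type}
  [∀ v h, Monoid (N v h)] (qData : QPilotData ObΔ N)
  (tq : ∀ (pp : Nat.Primes) (x : (thetaIndex X).Fibre (.inr pp)), haveI : Fact (pp : ℕ).Prime := ⟨pp.2⟩; kOf X pp.1 x)
  (t : ∀ (pp : Nat.Primes) (_ : Fin X.lstar) (x : (thetaIndex X).Fibre (.inr pp)),
    haveI : Fact (pp : ℕ).Prime := ⟨pp.2⟩; kOf X pp.1 x)
  (htq0 : ∀ pp x, tq pp x ≠ 0)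
  (htq1 : ∀ (pp : Nat.Primes) (x : (thetaIndex X).Fibre (.inr pp)),
    haveI : Fact (pp : ℕ).Prime := ⟨pp.2⟩; placeOf X pp.1 x ∉ X.S → ‖tq pp x‖ = 1)
  (ht0 : ∀ pp i x, t pp i x ≠ 0)
  (ht : ∀ (pp : Nat.Primes) (i : Fin X.lstar) (x : (thetaIndex X).Fibre (.inr pp)),
    haveI : Fact (pp : ℕ).Prime := ⟨pp.2⟩
    Real.log ‖t pp i x‖ = -(X.thetaPilot i (placeOf X pp.1 x)) * logNorm F (placeOf X pp.1 x) /
      localDegree F (placeOf X pp.1 x))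
  (htq : ∀ (pp : Nat.Primes) (x : (thetaIndex X).Fibre (.inr pp)),
    haveI : Fact (pp : ℕ).Prime := ⟨pp.2⟩
    Real.log ‖tq pp x‖ = -(X.qPilot (placeOf X pp.1 x)) * logNorm F (placeOf X pp.1 x) /
      localDegree F (placeOf X pp.1 x))

/-- **T1 (abc-iut-w5-d009 `licence_settingPrVolSharp_iff_of_realises_tame`, p448597) RE-DERIVED from T1½** (`…_of_realises_boundary`, p456372)
through `boundaryFibre_of_tameFibre` — statement copied verbatim; an `example`, so no second copy of the statement enters the tree.
[cite: DupuyHilado2025, §3.4, §4.9] [claim: Mochizuki2012, status: disputed] -/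
example (e : Nat.Primes → ℕ)
    (hfib : ∀ (pp : Nat.Primes) (x : (thetaIndex X).Fibre (.inr pp)),
      haveI : Fact (pp : ℕ).Prime := ⟨pp.2⟩
      (∃ w : (thetaIndex X).Fibre (.inr pp), placeOf X pp.1 w ∈ X.S) →
        2 < (pp : ℕ) ∧ e pp ≤ (pp : ℕ) - 2 ∧ (placeOf X pp.1 x).asIdeal.ramificationIdx ℤ = e pp)
    (P : ∀ pp : Nat.Primes, (thetaIndex X).Fibre (.inr pp) → ℕ)
    (hP : ∀ (pp : Nat.Primes) (w : (thetaIndex X).Fibre (.inr pp)),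
      haveI : Fact (pp : ℕ).Prime := ⟨pp.2⟩; placeOf X pp.1 w ∈ X.S → X.qPilot (placeOf X pp.1 w) = P pp w)
    (hP1 : ∀ (pp : Nat.Primes) (w : (thetaIndex X).Fibre (.inr pp)),
      haveI : Fact (pp : ℕ).Prime := ⟨pp.2⟩; placeOf X pp.1 w ∈ X.S → 1 ≤ P pp w) :
    Thm311ToCor312.Licence (settingPrVolSharp X hlog M archPk archSub Ψ act Mmod region n lat sig split qData tq t htq0 htq1) ↔
      ∀ (pp : Nat.Primes) (i : Fin (thetaIndex X).lstar) (w : (thetaIndex X).Fibre (.inr pp)),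
        haveI : Fact (pp : ℕ).Prime := ⟨pp.2⟩; placeOf X pp.1 w ∈ X.S →
          (e pp : ℤ) * (((((i : ℕ) + 1 : ℕ) : ℤ) ^ 2 * (P pp w : ℤ) - 1) / e pp) + 1 -
            ((i : ℕ) + 1 : ℕ) * ((e pp : ℤ) - 1) ≤ (P pp w : ℤ) :=
  licence_settingPrVolSharp_iff_of_realises_boundary X hlog M archPk archSub Ψ act Mmod region n lat sig split qData tq t htq0 htq1
    ht0 ht htq e (fun pp x hS => boundaryFibre_of_tameFibre X e hfib pp x hS) P hP hP1

end Summit.ABC.IUTFork.Thm311.Real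

namespace Summit.ABC.IUTFork.Cor312Prov

open Thm311 Thm311.Real Cor312 Cor312.Setting Cor312Vol Literature.IUT.LogThetaLattice Literature.IUT.LogVolume
  Literature.IUT.HodgeTheaters
open Literature.NumberTheory.NumberFields Literature.NumberTheory.GaloisRepresentations.Ultrametric

variable {F K Fbar : Type} [Field F] [NumberField F] [Field K] [NumberField K] [Algebra F K] [Field Fbar]
  [Algebra F Fbar] [Algebra K Fbar] {E : WeierstrassCurve F} [E.IsElliptic] {l : ℕ} {Pb : BadPlacePredicates K}
  (D : InitialThetaData F K Fbar E l Pb) {logv : PadicLogs K} (hlog : LogvAnalytic logv)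
  (M : Type) [Field M] [NumberField M]
  (archPk : ∀ (j : (thetaIndex (pilotDataOfK D K)).Label) (vQ : (thetaIndex (pilotDataOfK D K)).VQ),
    Set ((logShellsDH (pilotDataOfK D K) logv).Packet j vQ))
  (archSub : ∀ (j : (thetaIndex (pilotDataOfK D K)).Label) (v : (thetaIndex (pilotDataOfK D K)).V),
    Set ((logShellsDH (pilotDataOfK D K) logv).Packet j ((thetaIndex (pilotDataOfK D K)).over v)))
  (Ψ : ℤ → ∀ v : (thetaIndex (pilotDataOfK D K)).V, v ∈ (thetaIndex (pilotDataOfK D K)).Vbad →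
    Set ((logShellsDH (pilotDataOfK D K) logv).StarPacket v))
  (act : ℤ → ∀ v : (thetaIndex (pilotDataOfK D K)).V, v ∈ (thetaIndex (pilotDataOfK D K)).Vbad →
    (logShellsDH (pilotDataOfK D K) logv).StarPacket v → Module.End ℚ ((logShellsDH (pilotDataOfK D K) logv).StarPacket v))
  (Mmod : ℤ → ∀ j : (thetaIndex (pilotDataOfK D K)).LabelStar, Set ((logShellsDH (pilotDataOfK D K) logv).GlobalPacket j.1))
  (region : ℤ → ∀ j : (thetaIndex (pilotDataOfK D K)).LabelStar, FinDivisor M → ∀ vQ : (thetaIndex (pilotDataOfK D K)).VQ,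
    Set ((logShellsDH (pilotDataOfK D K) logv).Packet j.1 vQ))
  (n : ℤ) {HT : Type} {LogLink : HT → HT → Type} {IsFull : ∀ {s t : HT}, LogLink s t → Prop}
  (lat : LGPGaussianLogThetaLattice LogLink IsFull)
  {Frd : Type} {IsoF : Frd → Frd → Type} {Ob : Frd → Type} {realify : Frd → Frd} {Strip : Type}
  {IsoS : Strip → Strip → Type} {Mv : ∀ v : (thetaIndex (pilotDataOfK D K)).V, v ∈ (thetaIndex (pilotDataOfK D K)).Vbad → Type}
  [∀ v h, Monoid (Mv v h)]
  (sig : GlobalLGPFrobenioidSignature (thetaIndex (pilotDataOfK D K)).lstar (thetaIndex (pilotDataOfK D K)).V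
    (· ∈ (thetaIndex (pilotDataOfK D K)).Vbad) Frd IsoF Ob realify Strip IsoS Mv)
  (split : SplittingMonoids Mv) {ObΔ : Type} {N : ∀ v : (thetaIndex (pilotDataOfK D K)).V, v ∈ (thetaIndex (pilotDataOfK D K)).Vbad → Type}
  [∀ v h, Monoid (N v h)] (qData : QPilotData ObΔ N)
  (tq : ∀ (pp : Nat.Primes) (x : (thetaIndex (pilotDataOfK D K)).Fibre (.inr pp)),
    haveI : Fact (pp : ℕ).Prime := ⟨pp.2⟩; kOf (pilotDataOfK D K) pp.1 x)
  (t : ∀ (pp : Nat.Primes) (_ : Fin (pilotDataOfK D K).lstar) (x : (thetaIndex (pilotDataOfK D K)).Fibre (.inr pp)),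
    haveI : Fact (pp : ℕ).Prime := ⟨pp.2⟩; kOf (pilotDataOfK D K) pp.1 x)
  (htq0 : ∀ pp x, tq pp x ≠ 0)
  (htq1 : ∀ (pp : Nat.Primes) (x : (thetaIndex (pilotDataOfK D K)).Fibre (.inr pp)),
    haveI : Fact (pp : ℕ).Prime := ⟨pp.2⟩; placeOf (pilotDataOfK D K) pp.1 x ∉ (pilotDataOfK D K).S → ‖tq pp x‖ = 1)
  (ht0 : ∀ pp i x, t pp i x ≠ 0)
  (ht : ∀ (pp : Nat.Primes) (i : Fin (pilotDataOfK D K).lstar) (x : (thetaIndex (pilotDataOfK D K)).Fibre (.inr pp)),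
    haveI : Fact (pp : ℕ).Prime := ⟨pp.2⟩
    Real.log ‖t pp i x‖ = -((pilotDataOfK D K).thetaPilot i (placeOf (pilotDataOfK D K) pp.1 x)) *
      logNorm K (placeOf (pilotDataOfK D K) pp.1 x) / localDegree K (placeOf (pilotDataOfK D K) pp.1 x))
  (htq : ∀ (pp : Nat.Primes) (x : (thetaIndex (pilotDataOfK D K)).Fibre (.inr pp)),
    haveI : Fact (pp : ℕ).Prime := ⟨pp.2⟩
    Real.log ‖tq pp x‖ = -((pilotDataOfK D K).qPilot (placeOf (pilotDataOfK D K) pp.1 x)) *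
      logNorm K (placeOf (pilotDataOfK D K) pp.1 x) / localDegree K (placeOf (pilotDataOfK D K) pp.1 x))

/-- **T1 at the genuine `K`-level datum (abc-iut-w5-d009 `licence_settingPrVolSharp_pilotDataOfK_iff_of_tame`, p449282) RE-DERIVED from T1½**
(`…_pilotDataOfK_iff_of_boundary`, p456609) through `boundaryFibre_of_tameFibre` — statement copied verbatim; an `example`.
[cite: DupuyHilado2025, §3.4, §4.9] [claim: Mochizuki2012, status: disputed] -/
example (e : Nat.Primes → ℕ)
    (htame : ∀ (pp : Nat.Primes) (x : (thetaIndex (pilotDataOfK D K)).Fibre (.inr pp)),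
      haveI : Fact (pp : ℕ).Prime := ⟨pp.2⟩
      (∃ w : (thetaIndex (pilotDataOfK D K)).Fibre (.inr pp), placeOf (pilotDataOfK D K) pp.1 w ∈ (pilotDataOfK D K).S) →
        2 < (pp : ℕ) ∧ e pp ≤ (pp : ℕ) - 2 ∧ (placeOf (pilotDataOfK D K) pp.1 x).asIdeal.ramificationIdx ℤ = e pp) :
    Thm311ToCor312.Licence
        (settingPrVolSharp (pilotDataOfK D K) hlog M archPk archSub Ψ act Mmod region n lat sig split qData tq t htq0 htq1) ↔
      ∀ (pp : Nat.Primes) (i : Fin (pilotDataOfK D K).lstar) (w : (thetaIndex (pilotDataOfK D K)).Fibre (.inr pp)),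
        haveI : Fact (pp : ℕ).Prime := ⟨pp.2⟩
        placeOf (pilotDataOfK D K) pp.1 w ∈ (pilotDataOfK D K).S →
          ∀ P : ℕ, (pilotDataOfK D K).qPilot (placeOf (pilotDataOfK D K) pp.1 w) = P →
            (e pp : ℤ) * (((((i : ℕ) + 1 : ℕ) : ℤ) ^ 2 * (P : ℤ) - 1) / e pp) + 1 -
              ((i : ℕ) + 1 : ℕ) * ((e pp : ℤ) - 1) ≤ (P : ℤ) :=
  licence_settingPrVolSharp_pilotDataOfK_iff_of_boundary D hlog M archPk archSub Ψ act Mmod region n lat sig split qData tq t htq0 htq1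
    ht0 ht htq e (fun pp x hS => boundaryFibre_of_tameFibre (pilotDataOfK D K) e htame pp x hS)

end Summit.ABC.IUTFork.Cor312Prov

end
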